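import Summits.Ventures.DiscreteObjects.PP12.FlagSubcells

/-!
# PP(12), flag cell of order 3: the ORBIT MATRIX as ONE typed finite statement for every number `ρ` of c-line orbits (plain matrix form)
Framing: lottery ticket; floor = certified bounds/negative ranges.

Cell pub-namedobj (venture DiscreteObjects), target (M), designs gen 15; generic sibling of `FlagTenOrbitMatrix` (designs g12, `f = 10`)
and `FlagSevenOrbitMatrix` (designs g13, `f = 7`). A flag-type collineation `σ` (`σ³ = 1`) of a projective plane of order 12 — all fixed
points on the fixed line `l`, all fixed lines through the fixed point `c ∈ l` — with `f = 13 − 3ρ` fixed points has: `ρ` orbits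
`Γ_s` of non-fixed lines through `c` ('c-lines'), `ρ` orbits `Z_t` of non-fixed points on `l`, `12 − 3ρ` fixed lines `m_j ≠ l` (each
carrying four orbits `(j,t)` of non-fixed points) and `12 − 3ρ` fixed points `y_k ≠ c` (each on four orbits `(k,t)` of non-fixed
lines), and `12ρ` exterior orbit-triangles `(s,i)` (class `s` = the c-line orbit carrying the three vertices, `i : Fin 12` = the vertex
on a chosen line of `Γ_s`) with their `12ρ` side orbits. So the non-trivial part of the tactical decomposition of `⟨σ⟩` is a square
matrix over the index type `FRow ρ = FCol ρ = Fin ρ ⊕ (Fin ρ × Fin 12) ⊕ (Fin (12 − 3ρ) × Fin 4)` (`53, 55, 57, 59` orbits in all for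
`ρ = 4, 3, 2, 1`, i.e. `f = 1, 4, 7, 10`; `ρ = 0` is the elation case `f = 13`, `48` T-orbits).

`IsFlagOrbitMatrix ρ M` is the PLAIN MATRIX FORM of the orbit-matrix equations for `M r c = |(point orbit c) ∩ (a line of row orbit r)|`:
the row and column totals (`13 −` fixed points on the line / fixed lines through the point), the complete `λ = 1` systems of row
inner products and of column inner products over the non-trivial orbits (the fixed rows/columns eliminated — their contributions are
the constants in `rowTarget` / `colTarget`, exactly as in `FlagSevenOrbitData.rowTarget` / `colTarget`), the c-line rows written out
(`gammaEntry`: a line of `Γ_s` carries one vertex of each triangle of class `s` and no other non-fixed point off `c`), the T-line rows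
vanish on the `Z`-columns (a T-line meets `l` in its fixed point), and the side row `(s,i)` has its entry `2` at its own triangle.
Unlike the `f = 7, 10` statements no further structure (`κ, ψ, φ, R, γ, C, β`) is built in: this is the uniform statement a SAT / exact
engine takes as input for EVERY sub-cell, and for `f = 4` (`ρ = 3`) and `f = 1` (`ρ = 4`) it is the FIRST finite statement in the tree.

`FlagOrbitReduction ρ` (plane ⇒ matrix) is typed here and PROVED in `FlagOrbitReduction.lean` (designs g15) for every `ρ`;
`noFlagFixed_of_flagOrbitReduction` is the pure-logic bridge to the census statement `NoFlagOrder3Order12Fixed (13 − 3ρ)`.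
CENSUS STATUS (2026-08-23): `NoFlagOrbitMatrix ρ` is UNDECIDED for `ρ = 2, 3, 4` ('beyond bound k'); for `ρ = 1` (`f = 10`) the finer
structured orbit level `NoFlagTenOrbitMatrix` is decided EMPTY outside the kernel (designs g11/g12, referee police), which does not by
itself decide the plain form. Nothing in this file depends on any computation. No `sorry`, no new axioms.
-/

namespace Summit.Ventures.DiscreteObjects.PP12

open Configuration Finset
open scoped Classical

/-- Row index of the non-fixed part of the flag-cell orbit matrix with `ρ` c-line orbits: c-line orbit `Γ_s` | side orbit of the
triangle `(s,i)` | T-line orbit `(k,t)` through the fixed point `y_k ≠ c` (`k : Fin (12 − 3ρ)`). -/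
abbrev FRow (ρ : ℕ) := Fin ρ ⊕ (Fin ρ × Fin 12) ⊕ (Fin (12 - 3 * ρ) × Fin 4)

/-- Column index of the non-fixed part: l-orbit `Z_t` | exterior triangle `(s,i)` | T-point orbit `(j,t)` on the fixed line
`m_j ≠ l` (`j : Fin (12 − 3ρ)`). -/
abbrev FCol (ρ : ℕ) := Fin ρ ⊕ (Fin ρ × Fin 12) ⊕ (Fin (12 - 3 * ρ) × Fin 4)

namespace FlagOrbit

variable {ρ : ℕ}

/-- Row totals over the non-trivial columns: `13 −` the number of fixed points on a line of the row orbit (`c` on a c-line, none on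
a side, `y_k` on a T-line). -/
def rowSum : FRow ρ → ℕ
  | Sum.inl _ => 12
  | Sum.inr (Sum.inl _) => 13
  | Sum.inr (Sum.inr _) => 12

/-- Column totals over the non-trivial rows: `13 −` the number of fixed lines through a point of the column orbit (`l` through a
point of `Z_t`, none through an exterior point, `m_j` through a T-point). -/
def colSum : FCol ρ → ℕ
  | Sum.inl _ => 12
  | Sum.inr (Sum.inl _) => 13
  | Sum.inr (Sum.inr _) => 12

/-- Forced inner products of two rows over the non-trivial columns (`λ = 1` summed over the second orbit, minus the fixed columns):
a row with itself `n + 3 = 15` minus `3·#(fixed points on the line)`; two distinct rows `3`, except `0` for `Γ_s·Γ_{s'}` (common fixed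
point `c`) and for two T-line orbits through the same `y_k`. -/
def rowTarget : FRow ρ → FRow ρ → ℕ
  | Sum.inl s, Sum.inl s' => if s = s' then 12 else 0
  | Sum.inr (Sum.inl x), Sum.inr (Sum.inl x') => if x = x' then 15 else 3
  | Sum.inr (Sum.inr (k, t)), Sum.inr (Sum.inr (k', t')) => if (k, t) = (k', t') then 12 else if k = k' then 0 else 3
  | _, _ => 3

/-- Forced inner products of two columns over the non-trivial rows (dually): a column with itself `15` minus `3·#(fixed lines
through the point)`; two distinct columns `3`, except `0` for `Z_t·Z_{t'}` (both on `l`) and for two orbits on the same `m_j`. -/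
def colTarget : FCol ρ → FCol ρ → ℕ
  | Sum.inl t, Sum.inl t' => if t = t' then 12 else 0
  | Sum.inr (Sum.inl x), Sum.inr (Sum.inl x') => if x = x' then 15 else 3
  | Sum.inr (Sum.inr (j, t)), Sum.inr (Sum.inr (j', t')) => if (j, t) = (j', t') then 12 else if j = j' then 0 else 3
  | _, _ => 3

/-- The c-line rows written out: a line of `Γ_s` meets `l` and every `m_j` only in `c`, carries exactly one vertex of each triangle of
class `s`, and no point of a triangle of another class. -/
def gammaEntry (s : Fin ρ) : FCol ρ → ℕ
  | Sum.inr (Sum.inl (s', _)) => if s' = s then 1 else 0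
  | _ => 0

end FlagOrbit

/-- **The orbit-matrix equations of the flag cell with `ρ` c-line orbits** (plain matrix form, `f = 13 − 3ρ` fixed points): row and
column totals, the complete `λ = 1` systems of row and of column inner products over the non-trivial orbits, the c-line rows
written out, the T-line rows vanish on the `Z`-columns, and each side row has the entry `2` at its own triangle. -/
def IsFlagOrbitMatrix (ρ : ℕ) (M : FRow ρ → FCol ρ → ℕ) : Prop :=
  (∀ r : FRow ρ, ∑ c : FCol ρ, M r c = FlagOrbit.rowSum r) ∧
  (∀ c : FCol ρ, ∑ r : FRow ρ, M r c = FlagOrbit.colSum c) ∧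
  (∀ r r' : FRow ρ, ∑ c : FCol ρ, M r c * M r' c = FlagOrbit.rowTarget r r') ∧
  (∀ c c' : FCol ρ, ∑ r : FRow ρ, M r c * M r c' = FlagOrbit.colTarget c c') ∧
  (∀ (s : Fin ρ) (c : FCol ρ), M (Sum.inl s) c = FlagOrbit.gammaEntry s c) ∧
  (∀ (kt : Fin (12 - 3 * ρ) × Fin 4) (t : Fin ρ), M (Sum.inr (Sum.inr kt)) (Sum.inl t) = 0) ∧
  (∀ x : Fin ρ × Fin 12, M (Sum.inr (Sum.inl x)) (Sum.inr (Sum.inl x)) = 2)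

/-- **Census statement at the orbit level (typed; UNDECIDED for `ρ = 2, 3, 4` as of 2026-08-23):** no orbit matrix of the flag cell
with `ρ` c-line orbits (`f = 13 − 3ρ` fixed points) exists. -/
def NoFlagOrbitMatrix (ρ : ℕ) : Prop := ∀ M : FRow ρ → FCol ρ → ℕ, ¬ IsFlagOrbitMatrix ρ M

/-- **The orbit-matrix reduction of the flag cell with `ρ` c-line orbits** (typed here; PROVED for every `ρ` in
`FlagOrbitReduction.lean`): every projective plane of order 12 with a collineation `σ ≠ 1`, `σ³ = 1`, of flag type with exactly
`13 − 3ρ` fixed points yields a matrix satisfying `IsFlagOrbitMatrix ρ`. -/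
def FlagOrbitReduction (ρ : ℕ) : Prop :=
  ∀ (P L : Type) [Membership P L] [Fintype P] [Fintype L] [ProjectivePlane P L],
    ProjectivePlane.order P L = 12 → ∀ σ : Collineation P L, σ.onPoints ^ 3 = 1 → σ.onPoints ≠ 1 →
      (∃ (l : L) (c : P), σ.onLines l = l ∧ σ.onPoints c = c ∧ c ∈ l ∧
          (∀ p : P, σ.onPoints p = p → p ∈ l) ∧ (∀ m : L, σ.onLines m = m → c ∈ m) ∧ fixedCard σ.onPoints = 13 - 3 * ρ) →
      ∃ M : FRow ρ → FCol ρ → ℕ, IsFlagOrbitMatrix ρ M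

/-- **How the census uses the orbit level:** if the reduction holds for `ρ` and no orbit matrix exists, the sub-cell with
`13 − 3ρ` fixed points is empty (`NoFlagOrder3Order12Fixed (13 − 3ρ)`). Pure logic. -/
theorem noFlagFixed_of_flagOrbitReduction {ρ : ℕ} (hred : FlagOrbitReduction ρ) (hno : NoFlagOrbitMatrix ρ) :
    NoFlagOrder3Order12Fixed (13 - 3 * ρ) := by
  intro P L _ _ _ _ h12 σ hq hne hflag
  obtain ⟨M, hM⟩ := hred P L h12 σ hq hne hflag
  exact hno M hM

namespace IsFlagOrbitMatrix

variable {ρ : ℕ} {M : FRow ρ → FCol ρ → ℕ}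

/-- Sanity of the encoding: two different c-line rows are orthogonal over the non-trivial columns (they share only `c`). -/
theorem gamma_rows_orthogonal (h : IsFlagOrbitMatrix ρ M) {s s' : Fin ρ} (hss : s ≠ s') :
    ∑ c : FCol ρ, M (Sum.inl s) c * M (Sum.inl s') c = 0 := by
  rw [h.2.2.1 (Sum.inl s) (Sum.inl s')]; simp [FlagOrbit.rowTarget, hss]

/-- Sanity of the encoding: a side row has norm `15 = n + 3` (no fixed point on a side). -/
theorem side_row_norm (h : IsFlagOrbitMatrix ρ M) (x : Fin ρ × Fin 12) :
    ∑ c : FCol ρ, M (Sum.inr (Sum.inl x)) c * M (Sum.inr (Sum.inl x)) c = 15 := by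
  rw [h.2.2.1]; simp [FlagOrbit.rowTarget]

/-- **The c-line row `Γ_{s'}` is the indicator of the triangle columns of class `s'`,** so its inner product with any other row `r` is the
block sum of `r` over those columns; by `λ = 1` that block sum is `3` for every side row and every T-line row (a line not through `c`
meets the three lines of `Γ_{s'}` in three exterior points of three different triangles) — a consequence of the system, recorded here
because the engines use it as a propagation rule. -/
theorem tri_block_sum (h : IsFlagOrbitMatrix ρ M) (s' : Fin ρ) (r : FRow ρ) (hr : ∀ s : Fin ρ, r ≠ Sum.inl s) :
    ∑ i : Fin 12, M r (Sum.inr (Sum.inl (s', i))) = 3 := by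
  have hprod := h.2.2.1 (Sum.inl s') r
  have htarget : FlagOrbit.rowTarget (Sum.inl s') r = 3 := by
    rcases r with s | x | kt
    · exact absurd rfl (hr s)
    · rfl
    · rfl
  rw [htarget] at hprod
  have hrew : ∀ c : FCol ρ, M (Sum.inl s') c * M r c = if (∃ i : Fin 12, c = Sum.inr (Sum.inl (s', i))) then M r c else 0 := by
    intro c
    rw [h.2.2.2.2.1 s' c]
    rcases c with t | ⟨s, i⟩ | jt
    · simp [FlagOrbit.gammaEntry]
    · by_cases hs : s = s'
      · subst hs; simp [FlagOrbit.gammaEntry]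
      · simp [FlagOrbit.gammaEntry, hs]
    · simp [FlagOrbit.gammaEntry]
  rw [Finset.sum_congr rfl (fun c _ => hrew c), Finset.sum_ite, Finset.sum_const_zero, add_zero] at hprod
  refine Eq.trans ?_ hprod
  refine Finset.sum_bij (fun c _ => (Sum.inr (Sum.inl (s', c)) : FCol ρ)) (fun i _ => by simp) (fun i _ i' _ hh => by simpa using hh)
    (fun c hc => ?_) (fun i _ => rfl)
  obtain ⟨-, i, rfl⟩ := mem_filter.1 hc
  exact ⟨i, mem_univ _, rfl⟩

end IsFlagOrbitMatrix

end Summit.Ventures.DiscreteObjects.PP12
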